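import Summits.ValiantsHypothesis.ValiantsHypothesis.Theses.LacunarySymmetroid
import Summits.ValiantsHypothesis.ValiantsHypothesis.Theorems.LacunarySymmetroidMatrixDescartesCensusFrame
import Summits.ValiantsHypothesis.ValiantsHypothesis.Theorems.LacunarySymmetroidMatrixDescartesCensusCurrency
import Summits.ValiantsHypothesis.ValiantsHypothesis.Theorems.LacunarySymmetroidMatrixDescartesStubArith4
import Summits.ValiantsHypothesis.ValiantsHypothesis.Theorems.LacunarySymmetroidMatrixDescartesStubCommutingSector
import Literature.Combinatorics.Expanders.Concentrator

/-!
# `MatrixDescartes` — the sectors where the crux is a theorem, and the window that carries its content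

HONEST FRAMING.  Object-search cell `pub-symmetroid`, crux `Theses.LacunarySymmetroid.MatrixDescartes`
(ledger item `stmt-ValiantsHypothesis-18050`, route `LacunarySymmetroid`; seat `val-sym-mdr-p1`).  The crux reads
`∀ c q, 0 < q → ∃ K₀, ∀ K ≥ K₀, ∀ m ≤ 2^((⌊log₂K⌋+c)^c), ∀ d S (symmetric), Z^q ≤ 2^(K⌊log₂K⌋)`, `Z` the number of
distinct real zeros of `det (∑ X^(d l) • S l)`.  By the route's own assembly (`Theorems.lacunarySymmetroid_assembly_proof`)
it implies `VP ≠ VNP` over `ℂ`, so it is at least summit-hard on the proof side; NOTHING in this file is progress on it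
and nothing here is a claim about `VP ≠ VNP`.  What this file does is bookkeeping IN THE KERNEL, in the crux's own
quantifier shape, of WHERE the statement has content:

* §1–§2 **The Descartes sector.**  For every `q ≥ 1` and EVERY `K ≥ 1`, every format with `(12(m+K))^q ≤ K^(q+1)`
  — sizes `m ≤ K^(1+1/q)/12 − K`, a POWER of `K` — satisfies the crux's inequality `Z^q ≤ 2^(K⌊log₂K⌋)` for every
  symmetric pencil, by Descartes' rule of signs alone (`Z ≤ 2·C(m+K, K)` and `K^K·C(m+K,K) ≤ (3(m+K))^K`, i.e.
  `C(n,K) ≤ (e n/K)^K` with `e < 3`): `matrixDescartes_subpowerSector`, with the corollaries `m ≤ a·K`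
  (`matrixDescartes_linearSector`, `K ≥ (12(a+1))^q`) and `m ≤ M` (`matrixDescartes_boundedSector`).  This is the
  theory seat's «FORK THRESHOLD (i) / DESCARTES-TRIVIAL SECTOR» (`HOME/CONJECTURE.md` §1, v1.9.3, paper) and the
  desk's retired reading X3 («MDR at bounded `m` is a theorem», `K1-PENCILTRANSFER-ANSWER.md` §2), now kernel facts.
* §3 **The window.**  Consequently `MatrixDescartes` is EQUIVALENT to the same sentence asserted only at the formats
  with `K^(q+1) < (12(m+K))^q` (`matrixDescartes_iff_window`), resp. only at `m > a·K` for any fixed `a`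
  (`matrixDescartes_iff_superlinearWindow`): together with the size hypothesis, the entire content of the item is the
  window `K^(1+1/q)/12 − K < m ≤ 2^((⌊log₂K⌋+c)^c)` — super-power, at most quasi-polynomial sizes.  The finite census
  of the cell (`m ≤ 7`) and every thin format lie outside it.
* §4 **Fat-format absorption and the commuting sector.**  In the regime `m ≤ 2^((⌊log₂K⌋+c)^c)` any zero count
  of polynomial shape `Z ≤ 2^a (m+1)(K+1)` is absorbed by the budget (`fatFormat_absorb`, via the tree's `stub_arith4`);
  hence every SECTOR THEOREM of that shape is an instance of the crux at ALL fat formats.  Recorded instance: pairwise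
  COMMUTING symmetric coefficients (`stub_commutingSector`, `Z₊ ≤ m(K−1)` by a joint eigenbasis, applied to the pencil
  and to its reflection `X ↦ −X`): `matrixDescartes_commutingSector` — the crux holds verbatim on that sector, for all
  `c, q`.  All difficulty of the crux is in NON-commuting coefficients inside the window of §3; the cell's γ-ladder /
  fold / dead-end lemmas (CONJECTURE.md §2.1c, §3) are lower-bound mechanisms at `m = 2, 3` and give no upper bound there.
* §5 **The far edge of the window.**  Conversely (CONJECTURE.md §1 «FORK THRESHOLD (ii)»; the untyped quantitative
  remark of `K1-PENCILTRANSFER-ANSWER.md`, FILE NOTE (3)): if for infinitely many `K` some format in the regime at a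
  super-power height `m ≥ K^(1+1/s)` is Descartes-extremal UP TO A FIXED ROOT (`(ζ+1)^t ≥ D(m,K)+1`), then the crux is
  false (`not_matrixDescartes_of_powerExtremal_io`; square-tower instance `…_of_squareTowerRootExtremal_io`, whose
  `t = 1` case is the tree's `Census.not_matrixDescartes_of_squareTowerExtremal`).  A conditional refutation: its
  hypothesis concerns formats far outside the census and is not asserted.

Inputs (all tree theorems): `Census.realRootLawAt_descartes` (Descartes ceiling `Z ≤ 2·C(m+K−1,m) − 1`),
`Census.matrixDescartes_iff_posRootLaw` (the crux in `ζ`-currency), `stub_negRoots` (reflection),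
`stub_commutingSector`, `stub_arith4` (quasi-polynomial absorption),
`Literature.Combinatorics.Expanders.pow_self_le_three_pow_mul_factorial` (`K^K ≤ 3^K·K!`). [folklore]
-/

-- `Summit.ValiantsHypothesis.ValiantsHypothesis.…` repeats a component by the D-0017 layout
-- (single-conjunct summit), which the `dupNamespace` linter flags; the name is mandated.
set_option linter.dupNamespace false

namespace Summit.ValiantsHypothesis.ValiantsHypothesis.Theorems.LacunarySymmetroidMatrixDescartes.Census

open Summit.ValiantsHypothesis.ValiantsHypothesis.Theses.LacunarySymmetroid (MatrixDescartes)
open Summit.ValiantsHypothesis.ValiantsHypothesis.Theorems.MatrixDescartes.Negative (PosRootLawAt)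
open scoped BigOperators Matrix
open Polynomial

/-! ## §1 Descartes through the format -/

/-- For `K ≥ 1`, every `K`-term real symmetric `m × m` lacunary pencil has at most `2·C(m+K, K)` distinct real zeros
of its determinant: the tree's Descartes ceiling `Z ≤ 2·C(m+K−1, m) − 1` (`Census.realRootLawAt_descartes`) with
`C(m+K−1, m) ≤ C(m+K, m) = C(m+K, K)`. [folklore] -/
theorem card_roots_le_two_mul_choose (m K : ℕ) (hK : 0 < K) (d : Fin K → ℕ)
    (S : Fin K → Matrix (Fin m) (Fin m) ℝ) (hS : ∀ l, (S l).IsSymm) :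
    (Matrix.det (∑ l, ((Polynomial.X : Polynomial ℝ) ^ d l) • (S l).map Polynomial.C)).roots.toFinset.card
      ≤ 2 * Nat.choose (m + K) K := by
  have h1 := realRootLawAt_descartes m K hK d S hS
  have h2 : Nat.choose (m + K - 1) m ≤ Nat.choose (m + K) K :=
    calc Nat.choose (m + K - 1) m ≤ Nat.choose (m + K) m := Nat.choose_le_choose m (Nat.sub_le _ _)
      _ = Nat.choose (m + K) K := Nat.choose_symm_add
  omega

/-- `K^K · C(m+K, K) ≤ (3(m+K))^K` — the binomial bound `C(n, K) ≤ (e·n/K)^K` with `e < 3`, in `ℕ`: from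
`K! · C(m+K, K) = (m+K)·(m+K−1)⋯(m+1) ≤ (m+K)^K` and `K^K ≤ 3^K · K!`
(`Literature.Combinatorics.Expanders.pow_self_le_three_pow_mul_factorial`). [folklore] -/
theorem pow_self_mul_choose_le (m K : ℕ) : K ^ K * Nat.choose (m + K) K ≤ (3 * (m + K)) ^ K := by
  have h1 : K.factorial * Nat.choose (m + K) K ≤ (m + K) ^ K := by
    rw [← Nat.descFactorial_eq_factorial_mul_choose]
    exact Nat.descFactorial_le_pow _ _
  have h2 : K ^ K ≤ 3 ^ K * K.factorial :=
    Literature.Combinatorics.Expanders.pow_self_le_three_pow_mul_factorial K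
  calc K ^ K * Nat.choose (m + K) K ≤ 3 ^ K * K.factorial * Nat.choose (m + K) K :=
        Nat.mul_le_mul_right _ h2
    _ = 3 ^ K * (K.factorial * Nat.choose (m + K) K) := by ring
    _ ≤ 3 ^ K * (m + K) ^ K := Nat.mul_le_mul_left _ h1
    _ = (3 * (m + K)) ^ K := by rw [mul_pow]

/-- The arithmetic of the Descartes sector.  If `Z ≤ 2C`, `K^K · C ≤ (3N)^K` and `(12N)^q ≤ K^(q+1)` with `q, K ≥ 1`,
then `Z^q ≤ 2^(K⌊log₂K⌋)`: indeed `Z^q (K^K)^q 2^K ≤ 2^q 2^K (3N)^(Kq) ≤ (12N)^(qK) ≤ (K^K)^q K^K`, cancel `(K^K)^q`,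
and `K^K ≤ 2^(K(⌊log₂K⌋+1))`. [folklore] -/
theorem descartesSector_arith (q K N C Z : ℕ) (hq : 0 < q) (hK : 0 < K) (hZ : Z ≤ 2 * C)
    (hC : K ^ K * C ≤ (3 * N) ^ K) (hN : (12 * N) ^ q ≤ K ^ (q + 1)) :
    Z ^ q ≤ 2 ^ (K * Nat.log 2 K) := by
  -- `K ≤ 2^(⌊log₂K⌋+1)`, hence `K^K ≤ 2^(K⌊log₂K⌋) · 2^K`
  have hK2 : K ≤ 2 ^ (Nat.log 2 K + 1) := (Nat.lt_pow_succ_log_self one_lt_two K).le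
  have hKK : K ^ K ≤ 2 ^ (K * Nat.log 2 K) * 2 ^ K :=
    calc K ^ K ≤ (2 ^ (Nat.log 2 K + 1)) ^ K := Nat.pow_le_pow_left hK2 K
      _ = 2 ^ (K * Nat.log 2 K + K) := by rw [← pow_mul]; congr 1; ring
      _ = 2 ^ (K * Nat.log 2 K) * 2 ^ K := pow_add 2 _ _
  -- the main chain
  have h1 : Z ^ q ≤ (2 * C) ^ q := Nat.pow_le_pow_left hZ q
  have h3 : Z ^ q * (K ^ K) ^ q ≤ 2 ^ q * (3 * N) ^ (K * q) :=
    calc Z ^ q * (K ^ K) ^ q ≤ (2 * C) ^ q * (K ^ K) ^ q := Nat.mul_le_mul_right _ h1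
      _ = 2 ^ q * (K ^ K * C) ^ q := by rw [mul_pow, mul_pow]; ring
      _ ≤ 2 ^ q * ((3 * N) ^ K) ^ q := Nat.mul_le_mul_left _ (Nat.pow_le_pow_left hC q)
      _ = 2 ^ q * (3 * N) ^ (K * q) := by rw [← pow_mul]
  have h4 : 2 ^ q * 2 ^ K ≤ 4 ^ (K * q) := by
    have hqK : q + K ≤ 2 * (K * q) := by nlinarith
    calc 2 ^ q * 2 ^ K = 2 ^ (q + K) := (pow_add 2 q K).symm
      _ ≤ 2 ^ (2 * (K * q)) := Nat.pow_le_pow_right (by norm_num) hqK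
      _ = 4 ^ (K * q) := by rw [pow_mul]; norm_num
  have h5 : ((12 * N) ^ q) ^ K ≤ (K ^ (q + 1)) ^ K := Nat.pow_le_pow_left hN K
  have h6 : (K ^ (q + 1)) ^ K = (K ^ K) ^ q * K ^ K := by
    rw [← pow_mul, ← pow_mul, ← pow_add]; congr 1; ring
  have h7 : ((12 * N) ^ q) ^ K = 4 ^ (K * q) * (3 * N) ^ (K * q) := by
    rw [← pow_mul, show (12 : ℕ) * N = 4 * (3 * N) by ring, mul_pow, mul_comm q K]
  have h8 : Z ^ q * (K ^ K) ^ q * 2 ^ K ≤ (K ^ K) ^ q * K ^ K :=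
    calc Z ^ q * (K ^ K) ^ q * 2 ^ K ≤ 2 ^ q * (3 * N) ^ (K * q) * 2 ^ K := Nat.mul_le_mul_right _ h3
      _ = (2 ^ q * 2 ^ K) * (3 * N) ^ (K * q) := by ring
      _ ≤ 4 ^ (K * q) * (3 * N) ^ (K * q) := Nat.mul_le_mul_right _ h4
      _ = ((12 * N) ^ q) ^ K := h7.symm
      _ ≤ (K ^ (q + 1)) ^ K := h5
      _ = (K ^ K) ^ q * K ^ K := h6
  have h9 : Z ^ q * 2 ^ K ≤ K ^ K := by
    have hPq : 0 < (K ^ K) ^ q := pow_pos (pow_pos hK K) q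
    have h' : (K ^ K) ^ q * (Z ^ q * 2 ^ K) ≤ (K ^ K) ^ q * K ^ K :=
      calc (K ^ K) ^ q * (Z ^ q * 2 ^ K) = Z ^ q * (K ^ K) ^ q * 2 ^ K := by ring
        _ ≤ (K ^ K) ^ q * K ^ K := h8
    exact Nat.le_of_mul_le_mul_left h' hPq
  exact Nat.le_of_mul_le_mul_right (h9.trans hKK) (pow_pos two_pos K)

/-! ## §2 The Descartes sector of the crux -/

/-- **The sub-power size sector of the crux** (theory seat, `HOME/CONJECTURE.md` §1 «FORK THRESHOLD (i)», kernel
form).  For every `q` and EVERY `K ≥ 1`: if `(12(m+K))^q ≤ K^(q+1)` — i.e. `m ≤ K^(1+1/q)/12 − K`, sizes up to a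
power `K^(1+1/q)` of the number of terms — then every `K`-term real symmetric `m × m` lacunary pencil satisfies the
crux's inequality `Z^q ≤ 2^(K⌊log₂K⌋)`, by Descartes' rule alone (`Z ≤ 2·C(m+K, K) ≤ 2·(3(m+K)/K)^K`).  No threshold
`K₀`, no size parameter `c` and no matrix structure are needed: on this sector `MatrixDescartes` has no content. [folklore] -/
theorem matrixDescartes_subpowerSector (q K m : ℕ) (hK : 0 < K) (hmK : (12 * (m + K)) ^ q ≤ K ^ (q + 1))
    (d : Fin K → ℕ) (S : Fin K → Matrix (Fin m) (Fin m) ℝ) (hS : ∀ l, (S l).IsSymm) :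
    (Matrix.det (∑ l, ((Polynomial.X : Polynomial ℝ) ^ d l) • (S l).map Polynomial.C)).roots.toFinset.card ^ q
      ≤ 2 ^ (K * Nat.log 2 K) := by
  rcases Nat.eq_zero_or_pos q with rfl | hq
  · rw [pow_zero]
    exact Nat.one_le_two_pow
  · exact descartesSector_arith q K (m + K) (Nat.choose (m + K) K) _ hq hK
      (card_roots_le_two_mul_choose m K hK d S hS) (pow_self_mul_choose_le m K) hmK

/-- **Linear-size sector**, in the crux's own quantifier shape: for all `a, q` there is `K₀` (namely
`max 1 (12(a+1))^q`) such that for `K ≥ K₀` every format with `m ≤ a·K` satisfies `Z^q ≤ 2^(K⌊log₂K⌋)` for every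
symmetric pencil — `MatrixDescartes` restricted to sizes `m = O(K)` is a theorem by Descartes (`log₂ Z = O_a(K)`). [folklore] -/
theorem matrixDescartes_linearSector (a q : ℕ) : ∃ K₀ : ℕ, ∀ K m : ℕ, K₀ ≤ K → m ≤ a * K →
    ∀ (d : Fin K → ℕ) (S : Fin K → Matrix (Fin m) (Fin m) ℝ), (∀ l, (S l).IsSymm) →
      (Matrix.det (∑ l, ((Polynomial.X : Polynomial ℝ) ^ d l) • (S l).map Polynomial.C)).roots.toFinset.card ^ q
        ≤ 2 ^ (K * Nat.log 2 K) := by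
  refine ⟨max 1 ((12 * (a + 1)) ^ q), fun K m hK hm d S hS => ?_⟩
  have hK1 : 1 ≤ K := le_of_max_le_left hK
  have hK2 : (12 * (a + 1)) ^ q ≤ K := le_of_max_le_right hK
  refine matrixDescartes_subpowerSector q K m hK1 ?_ d S hS
  have hmK : 12 * (m + K) ≤ 12 * (a + 1) * K := by nlinarith
  calc (12 * (m + K)) ^ q ≤ (12 * (a + 1) * K) ^ q := Nat.pow_le_pow_left hmK q
    _ = (12 * (a + 1)) ^ q * K ^ q := mul_pow _ _ _
    _ ≤ K * K ^ q := Nat.mul_le_mul_right _ hK2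
    _ = K ^ (q + 1) := (pow_succ' K q).symm

/-- **Bounded-size («tame») sector** — the desk's retired reading X3 «`MatrixDescartes` restricted to bounded `m` is
a theorem» (`K1-PENCILTRANSFER-ANSWER.md` §2) made a kernel fact: for fixed `M` and `q`, for all `K ≥ K₀(M, q)` every
format with `m ≤ M` satisfies the crux's inequality.  In particular every census format of the cell (`m ≤ 7`) is of
this kind: the census reads mechanisms, it cannot bear on the crux. [folklore] -/
theorem matrixDescartes_boundedSector (M q : ℕ) : ∃ K₀ : ℕ, ∀ K m : ℕ, K₀ ≤ K → m ≤ M →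
    ∀ (d : Fin K → ℕ) (S : Fin K → Matrix (Fin m) (Fin m) ℝ), (∀ l, (S l).IsSymm) →
      (Matrix.det (∑ l, ((Polynomial.X : Polynomial ℝ) ^ d l) • (S l).map Polynomial.C)).roots.toFinset.card ^ q
        ≤ 2 ^ (K * Nat.log 2 K) := by
  obtain ⟨K₀, hK₀⟩ := matrixDescartes_linearSector 1 q
  refine ⟨max M K₀, fun K m hK hm d S hS => hK₀ K m (le_of_max_le_right hK) ?_ d S hS⟩
  have hMK : M ≤ K := le_of_max_le_left hK
  omega

/-! ## §3 The crux reduced to its window -/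

/-- **The crux reduced to its window.**  `MatrixDescartes` is EQUIVALENT to the same sentence asserted only at the
formats OUTSIDE the Descartes sector, `K^(q+1) < (12(m+K))^q` (i.e. `m > K^(1+1/q)/12 − K`).  With the size hypothesis
this says: the entire content of `stmt-ValiantsHypothesis-18050` is the window
`K^(1+1/q)/12 − K < m ≤ 2^((⌊log₂K⌋+c)^c)` — super-power, at most quasi-polynomial, sizes.  (Bookkeeping only: both
sides are the open crux.) [folklore] -/
theorem matrixDescartes_iff_window : MatrixDescartes ↔
    ∀ c q : ℕ, 0 < q → ∃ K₀ : ℕ, ∀ K m : ℕ, K₀ ≤ K → K ^ (q + 1) < (12 * (m + K)) ^ q →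
      m ≤ 2 ^ ((Nat.log 2 K + c) ^ c) →
      ∀ (d : Fin K → ℕ) (S : Fin K → Matrix (Fin m) (Fin m) ℝ), (∀ l, (S l).IsSymm) →
        (Matrix.det (∑ l, ((Polynomial.X : Polynomial ℝ) ^ d l) • (S l).map Polynomial.C)).roots.toFinset.card ^ q
          ≤ 2 ^ (K * Nat.log 2 K) := by
  constructor
  · intro h c q hq
    obtain ⟨K₀, hK₀⟩ := h c q hq
    exact ⟨K₀, fun K m hK _ hm d S hS => hK₀ K m hK hm d S hS⟩
  · intro h c q hq
    obtain ⟨K₀, hK₀⟩ := h c q hq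
    refine ⟨max 1 K₀, fun K m hK hm d S hS => ?_⟩
    have hK1 : 1 ≤ K := le_of_max_le_left hK
    rcases le_or_gt ((12 * (m + K)) ^ q) (K ^ (q + 1)) with hle | hlt
    · exact matrixDescartes_subpowerSector q K m hK1 hle d S hS
    · exact hK₀ K m (le_of_max_le_right hK) hlt hm d S hS

/-- **Super-linear window**, the same reduction at linear scale: for every fixed `a`, `MatrixDescartes` is equivalent
to the sentence asserted only at the formats with `a·K < m` (`≤ 2^((⌊log₂K⌋+c)^c)`); the linear-size formats are
supplied by `matrixDescartes_linearSector`. [folklore] -/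
theorem matrixDescartes_iff_superlinearWindow (a : ℕ) : MatrixDescartes ↔
    ∀ c q : ℕ, 0 < q → ∃ K₀ : ℕ, ∀ K m : ℕ, K₀ ≤ K → a * K < m →
      m ≤ 2 ^ ((Nat.log 2 K + c) ^ c) →
      ∀ (d : Fin K → ℕ) (S : Fin K → Matrix (Fin m) (Fin m) ℝ), (∀ l, (S l).IsSymm) →
        (Matrix.det (∑ l, ((Polynomial.X : Polynomial ℝ) ^ d l) • (S l).map Polynomial.C)).roots.toFinset.card ^ q
          ≤ 2 ^ (K * Nat.log 2 K) := by
  constructor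
  · intro h c q hq
    obtain ⟨K₀, hK₀⟩ := h c q hq
    exact ⟨K₀, fun K m hK _ hm d S hS => hK₀ K m hK hm d S hS⟩
  · intro h c q hq
    obtain ⟨K₀, hK₀⟩ := h c q hq
    obtain ⟨K₁, hK₁⟩ := matrixDescartes_linearSector a q
    refine ⟨max K₁ K₀, fun K m hK hm d S hS => ?_⟩
    rcases le_or_gt m (a * K) with hle | hlt
    · exact hK₁ K m (le_of_max_le_left hK) hle d S hS
    · exact hK₀ K m (le_of_max_le_right hK) hlt hm d S hS

/-! ## §4 Fat-format absorption; the commuting sector at all fat formats -/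

/-- **Fat-format absorption.**  In the crux's regime `m ≤ 2^((⌊log₂K⌋+c)^c)`, any count that is at most
`2^a·(m+1)·(K+1)` — polynomial in the format — satisfies `Z^q ≤ 2^(K⌊log₂K⌋)` for all `K ≥ K₀(a, c, q)`: one has
`Z ≤ 2^((⌊log₂K⌋ + (c+a+3))^(c+a+3))`, and the tree's `stub_arith4` absorbs that.  This is the arithmetic by which
every sector theorem of polynomial shape (`Z₊ ≤ m(K−1)` for commuting or definite coefficients, `Z₊ ≤ m` under
Loewner-ordered terms, `Z ≤ 2m+1` for two terms, …) becomes an instance of the crux at ALL fat formats. [folklore] -/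
theorem fatFormat_absorb (a c q : ℕ) : ∃ K₀ : ℕ, ∀ K m Z : ℕ, K₀ ≤ K → m ≤ 2 ^ ((Nat.log 2 K + c) ^ c) →
    Z ≤ 2 ^ a * (m + 1) * (K + 1) → Z ^ q ≤ 2 ^ (K * Nat.log 2 K) := by
  obtain ⟨K₁, hK₁⟩ := stub_arith4 (c + a + 3) q
  refine ⟨K₁, fun K m Z hK hm hZ => hK₁ K Z hK ?_⟩
  have hK2 : K + 1 ≤ 2 ^ (Nat.log 2 K + 1) := Nat.lt_pow_succ_log_self one_lt_two K
  have hm2 : m + 1 ≤ 2 ^ ((Nat.log 2 K + c) ^ c + 1) := by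
    have h1 : 1 ≤ 2 ^ ((Nat.log 2 K + c) ^ c) := Nat.one_le_two_pow
    rw [pow_succ]
    omega
  -- the exponent bookkeeping: `a + ((L+c)^c + 1) + (L+1) ≤ (L + (c+a+3))^(c+a+3)`
  have hb : 2 ≤ Nat.log 2 K + (c + a + 3) := by omega
  have hA : (Nat.log 2 K + c) ^ c ≤ (Nat.log 2 K + (c + a + 3)) ^ (c + a + 2) :=
    calc (Nat.log 2 K + c) ^ c ≤ (Nat.log 2 K + (c + a + 3)) ^ c := Nat.pow_le_pow_left (by omega) c
      _ ≤ (Nat.log 2 K + (c + a + 3)) ^ (c + a + 2) := Nat.pow_le_pow_right (by omega) (by omega)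
  have hB : Nat.log 2 K + (c + a + 3) ≤ (Nat.log 2 K + (c + a + 3)) ^ (c + a + 2) :=
    calc Nat.log 2 K + (c + a + 3) = (Nat.log 2 K + (c + a + 3)) ^ 1 := (pow_one _).symm
      _ ≤ (Nat.log 2 K + (c + a + 3)) ^ (c + a + 2) := Nat.pow_le_pow_right (by omega) (by omega)
  have hexp : a + ((Nat.log 2 K + c) ^ c + 1) + (Nat.log 2 K + 1)
      ≤ (Nat.log 2 K + (c + a + 3)) ^ (c + a + 3) :=
    calc a + ((Nat.log 2 K + c) ^ c + 1) + (Nat.log 2 K + 1)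
        ≤ (Nat.log 2 K + (c + a + 3)) ^ (c + a + 2) + (Nat.log 2 K + (c + a + 3)) ^ (c + a + 2) := by omega
      _ = (Nat.log 2 K + (c + a + 3)) ^ (c + a + 2) * 2 := by ring
      _ ≤ (Nat.log 2 K + (c + a + 3)) ^ (c + a + 2) * (Nat.log 2 K + (c + a + 3)) :=
          Nat.mul_le_mul_left _ hb
      _ = (Nat.log 2 K + (c + a + 3)) ^ (c + a + 3) := (pow_succ _ (c + a + 2)).symm
  calc Z ≤ 2 ^ a * (m + 1) * (K + 1) := hZ
    _ ≤ 2 ^ a * 2 ^ ((Nat.log 2 K + c) ^ c + 1) * 2 ^ (Nat.log 2 K + 1) :=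
        Nat.mul_le_mul (Nat.mul_le_mul_left _ hm2) hK2
    _ = 2 ^ (a + ((Nat.log 2 K + c) ^ c + 1) + (Nat.log 2 K + 1)) := by rw [← pow_add, ← pow_add]
    _ ≤ 2 ^ ((Nat.log 2 K + (c + a + 3)) ^ (c + a + 3)) := Nat.pow_le_pow_right (by norm_num) hexp

/-- **`MatrixDescartes` holds verbatim on the commuting-coefficient sector, at all fat formats.**  For all `c, q`
there is `K₀` such that for `K ≥ K₀`, `m ≤ 2^((⌊log₂K⌋+c)^c)` and pairwise COMMUTING real symmetric coefficients
`S l`, the crux's inequality `Z^q ≤ 2^(K⌊log₂K⌋)` holds.  Input: the tree's sector bound `Z₊ ≤ m(K−1)`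
(`stub_commutingSector`: in a joint orthonormal eigenbasis the determinant is a product of `m` real `K`-nomials), for
the pencil and for its reflection `X ↦ −X` (`S l ↦ (−1)^(d l) • S l`, still symmetric and commuting), so
`Z ≤ 2m(K−1) + 1` (`stub_negRoots`); then `fatFormat_absorb`.  A SECTOR theorem: it is silent about non-commuting
coefficients, where all the difficulty of the crux lies. [folklore] -/
theorem matrixDescartes_commutingSector (c q : ℕ) : ∃ K₀ : ℕ, ∀ K m : ℕ, K₀ ≤ K →
    m ≤ 2 ^ ((Nat.log 2 K + c) ^ c) →
    ∀ (d : Fin K → ℕ) (S : Fin K → Matrix (Fin m) (Fin m) ℝ), (∀ l, (S l).IsSymm) →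
      (∀ l l', S l * S l' = S l' * S l) →
      (Matrix.det (∑ l, ((Polynomial.X : Polynomial ℝ) ^ d l) • (S l).map Polynomial.C)).roots.toFinset.card ^ q
        ≤ 2 ^ (K * Nat.log 2 K) := by
  obtain ⟨K₀, hK₀⟩ := fatFormat_absorb 2 c q
  refine ⟨K₀, fun K m hK hm d S hS hcomm => hK₀ K m _ hK hm ?_⟩
  have h1 := stub_commutingSector K m d S hS hcomm
  have hS' : ∀ l, (((-1 : ℝ) ^ d l) • S l).IsSymm := fun l => (hS l).smul _
  have hcomm' : ∀ l l', (((-1 : ℝ) ^ d l) • S l) * (((-1 : ℝ) ^ d l') • S l') =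
      (((-1 : ℝ) ^ d l') • S l') * (((-1 : ℝ) ^ d l) • S l) := by
    intro l l'
    rw [Matrix.smul_mul, Matrix.mul_smul, Matrix.smul_mul, Matrix.mul_smul, hcomm l l', smul_comm]
  have h2 : ((Matrix.det (∑ l, ((Polynomial.X : Polynomial ℝ) ^ d l) •
      (((-1 : ℝ) ^ d l) • S l).map Polynomial.C)).roots.toFinset.filter (fun t => 0 < t)).card ≤ m * (K - 1) :=
    stub_commutingSector K m d (fun l => ((-1 : ℝ) ^ d l) • S l) hS' hcomm'
  have h3 := stub_negRoots K m d S
  have h4 : m * (K - 1) ≤ m * K := Nat.mul_le_mul_left m (Nat.sub_le K 1)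
  have h5 : 2 ^ 2 * (m + 1) * (K + 1) = 4 * (m * K) + 4 * m + 4 * K + 4 := by ring
  rw [h5]
  omega

/-! ## §5 The far edge of the window: power-extremality along any super-power tower refutes the crux -/

/-- Binomial lower bound in `ℕ`: `m^k ≤ k^k · C(m+k, k)` (from `k! · C(m+k, k) = (m+k)⋯(m+1) ≥ (m+1)^k` and
`k! ≤ k^k`), i.e. `C(m+k, k) ≥ (m/k)^k`. [folklore] -/
theorem pow_le_pow_self_mul_choose (m k : ℕ) : m ^ k ≤ k ^ k * Nat.choose (m + k) k := by
  have h1 : (m + 1) ^ k ≤ k.factorial * Nat.choose (m + k) k := by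
    rw [← Nat.descFactorial_eq_factorial_mul_choose]
    have h := Nat.pow_sub_le_descFactorial (m + k) k
    have e : m + k + 1 - k = m + 1 := by omega
    rwa [e] at h
  calc m ^ k ≤ (m + 1) ^ k := Nat.pow_le_pow_left (Nat.le_succ m) k
    _ ≤ k.factorial * Nat.choose (m + k) k := h1
    _ ≤ k ^ k * Nat.choose (m + k) k := Nat.mul_le_mul_right _ (Nat.factorial_le_pow k)

/-- **The far edge of the window (theory seat, `HOME/CONJECTURE.md` §1 «FORK THRESHOLD (ii)», kernel form; the
quantitative square-tower remark of `K1-PENCILTRANSFER-ANSWER.md` FILE NOTE (3) generalised).**  Fix `s, t ≥ 1` and a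
size exponent `c₀`.  Suppose that for infinitely many `K` there is a format `(m, K)` inside the crux's regime
(`m ≤ 2^((⌊log₂K⌋+c₀)^c₀)`) at tower height `m ≥ K^(1+1/s)` (typed `K^(s+1) ≤ m^s`) at which the symmetric census is
Descartes-extremal UP TO THE `t`-TH ROOT: every valid row `PosRootLawAt m K B` has `(B+1)^t ≥ C(m+K−1, m) = D(m,K)+1`
(equivalently `(ζ_sym(m,K)+1)^t ≥ D(m,K)+1`).  Then `MatrixDescartes` is false: the crux at `(c₀, q = 2st)` caps
`(2ζ+1)^(2st) ≤ 2^(K⌊log₂K⌋) ≤ K^K`, while `C(m+K−1, m) ≥ (m/(K−1))^(K−1) ≥ K^((K−1)/s)` gives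
`(ζ+1)^(2st) ≥ K^(2K−2) > K^K`.  With §2 this is the complete FORK WINDOW in the kernel: below `m ≈ K^(1+1/q)` the
`q`-th inequality of the crux is free; at any super-power height, extremality even up to a fixed root kills it.  The
hypothesis is a statement about formats far outside the cell's census; nothing is asserted about it. [folklore] -/
theorem not_matrixDescartes_of_powerExtremal_io (s t c₀ : ℕ) (hs : 0 < s) (ht : 0 < t)
    (hT : ∀ K₁ : ℕ, ∃ K m : ℕ, K₁ ≤ K ∧ K ^ (s + 1) ≤ m ^ s ∧ m ≤ 2 ^ ((Nat.log 2 K + c₀) ^ c₀) ∧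
      ∀ B : ℕ, PosRootLawAt m K B → Nat.choose (m + K - 1) m ≤ (B + 1) ^ t) :
    ¬ MatrixDescartes := by
  intro hMD
  obtain ⟨K₀, hK₀⟩ := (matrixDescartes_iff_posRootLaw.1 hMD) c₀ (2 * s * t) (Nat.mul_pos (Nat.mul_pos two_pos hs) ht)
  obtain ⟨K, m, hK₁, hKm, hm, hrow⟩ := hT (max K₀ 3)
  have hK0 : K₀ ≤ K := le_of_max_le_left hK₁
  have hK3 : 3 ≤ K := le_of_max_le_right hK₁
  obtain ⟨B, hB, hBq⟩ := hK₀ K m hK0 hm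
  have hD : Nat.choose (m + K - 1) m ≤ (B + 1) ^ t := hrow B hB
  -- write `K = k + 1` and `C(m+K-1, m) = C(m+k, k)`
  obtain ⟨k, rfl⟩ : ∃ k, K = k + 1 := ⟨K - 1, by omega⟩
  have e1 : m + (k + 1) - 1 = m + k := by omega
  rw [e1, Nat.choose_symm_add] at hD
  -- lower bound: `(k+1)^k ≤ C(m+k, k)^s`
  have hlow : m ^ k ≤ k ^ k * Nat.choose (m + k) k := pow_le_pow_self_mul_choose m k
  have h1 : ((k + 1) ^ (s + 1)) ^ k ≤ (m ^ s) ^ k := Nat.pow_le_pow_left hKm k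
  have h2 : (m ^ s) ^ k = (m ^ k) ^ s := by rw [← pow_mul, ← pow_mul, mul_comm]
  have h3 : (m ^ k) ^ s ≤ (k ^ k * Nat.choose (m + k) k) ^ s := Nat.pow_le_pow_left hlow s
  have h4 : (k ^ k * Nat.choose (m + k) k) ^ s ≤ ((k + 1) ^ k) ^ s * (Nat.choose (m + k) k) ^ s := by
    rw [mul_pow]
    exact Nat.mul_le_mul_right _ (Nat.pow_le_pow_left (Nat.pow_le_pow_left (Nat.le_succ k) k) s)
  have h5 : ((k + 1) ^ (s + 1)) ^ k = ((k + 1) ^ k) ^ s * (k + 1) ^ k := by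
    rw [← pow_mul, ← pow_mul, ← pow_add]; congr 1; ring
  have h6 : (k + 1) ^ k ≤ (Nat.choose (m + k) k) ^ s := by
    have hpos : 0 < ((k + 1) ^ k) ^ s := pow_pos (pow_pos (Nat.succ_pos k) k) s
    have h' : ((k + 1) ^ k) ^ s * (k + 1) ^ k ≤ ((k + 1) ^ k) ^ s * (Nat.choose (m + k) k) ^ s :=
      calc ((k + 1) ^ k) ^ s * (k + 1) ^ k = ((k + 1) ^ (s + 1)) ^ k := h5.symm
        _ ≤ (m ^ s) ^ k := h1
        _ = (m ^ k) ^ s := h2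
        _ ≤ (k ^ k * Nat.choose (m + k) k) ^ s := h3
        _ ≤ ((k + 1) ^ k) ^ s * (Nat.choose (m + k) k) ^ s := h4
    exact Nat.le_of_mul_le_mul_left h' hpos
  -- the crux's cap: `((k+1)^k)^2 ≤ (2B+1)^(2st) ≤ 2^(K⌊log₂K⌋) ≤ K^K`
  have h7 : (k + 1) ^ k ≤ (2 * B + 1) ^ (t * s) :=
    calc (k + 1) ^ k ≤ (Nat.choose (m + k) k) ^ s := h6
      _ ≤ ((B + 1) ^ t) ^ s := Nat.pow_le_pow_left hD s
      _ = (B + 1) ^ (t * s) := by rw [← pow_mul]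
      _ ≤ (2 * B + 1) ^ (t * s) := Nat.pow_le_pow_left (by omega) _
  have h8 : ((k + 1) ^ k) ^ 2 ≤ 2 ^ ((k + 1) * Nat.log 2 (k + 1)) :=
    calc ((k + 1) ^ k) ^ 2 ≤ ((2 * B + 1) ^ (t * s)) ^ 2 := Nat.pow_le_pow_left h7 2
      _ = (2 * B + 1) ^ (2 * s * t) := by rw [← pow_mul]; congr 1; ring
      _ ≤ 2 ^ ((k + 1) * Nat.log 2 (k + 1)) := hBq
  have h9 : 2 ^ ((k + 1) * Nat.log 2 (k + 1)) ≤ (k + 1) ^ (k + 1) :=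
    calc 2 ^ ((k + 1) * Nat.log 2 (k + 1)) = (2 ^ Nat.log 2 (k + 1)) ^ (k + 1) := by rw [← pow_mul, mul_comm]
      _ ≤ (k + 1) ^ (k + 1) := Nat.pow_le_pow_left (Nat.pow_log_le_self 2 (by omega)) _
  -- but `(k+1)^(k+1) < (k+1)^(2k)` for `k ≥ 2`
  have h10 : (k + 1) ^ (k + 1) < ((k + 1) ^ k) ^ 2 := by
    rw [← pow_mul]
    exact Nat.pow_lt_pow_right (by omega) (by omega)
  omega

/-- **Square-tower instance** (`s = 1`, `m = K²`, `c₀ = 2`): if for infinitely many `K` every valid row at the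
format `(K², K)` has `(B+1)^t ≥ C(K²+K−1, K²)` — Descartes-extremality of the square tower up to the `t`-th root,
infinitely often — then the crux fails.  For `t = 1` and «all `K ≥ 4`» this is the tree's
`Census.not_matrixDescartes_of_squareTowerExtremal`. [folklore] -/
theorem not_matrixDescartes_of_squareTowerRootExtremal_io (t : ℕ) (ht : 0 < t)
    (hT : ∀ K₁ : ℕ, ∃ K : ℕ, K₁ ≤ K ∧
      ∀ B : ℕ, PosRootLawAt (K ^ 2) K B →
        Nat.choose (K ^ 2 + K - 1) (K ^ 2) ≤ (B + 1) ^ t) :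
    ¬ MatrixDescartes := by
  refine not_matrixDescartes_of_powerExtremal_io 1 t 2 one_pos ht fun K₁ => ?_
  obtain ⟨K, hK, hrow⟩ := hT K₁
  refine ⟨K, K ^ 2, hK, by rw [pow_one], ?_, hrow⟩
  -- `K² ≤ 2^((⌊log₂K⌋+2)^2)`
  have hK2 : K ≤ 2 ^ (Nat.log 2 K + 1) := (Nat.lt_pow_succ_log_self one_lt_two K).le
  calc K ^ 2 ≤ (2 ^ (Nat.log 2 K + 1)) ^ 2 := Nat.pow_le_pow_left hK2 2
    _ = 2 ^ ((Nat.log 2 K + 1) * 2) := by rw [← pow_mul]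
    _ ≤ 2 ^ ((Nat.log 2 K + 2) ^ 2) := Nat.pow_le_pow_right (by norm_num) (by nlinarith)

end Summit.ValiantsHypothesis.ValiantsHypothesis.Theorems.LacunarySymmetroidMatrixDescartes.Census
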